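import Summits.CriticalPhenomena.PercolationContinuityZ3.Theorems.Transplant.FKConnectivityAllQForestTriangleClaw
import HarnessLib

/-!
# The triangle-claw reduction with TWO inner pairs (feet spanning a path `b – a – c`)

Support file (`--supports stmt-CriticalPhenomena-4575`), FK sub-lane `prim-bschramm-fk-1` (generation 23) of the post-continuity programme;
builds on p205010 (kernel theorem, internal audit signed; external expert review pending).  No definitions, no named facts, no sorries;
standard axioms.

`adjForestNoSq_fibre_of_triangleClaw_free` (file `…ForestTriangleClaw`) treats a degree-3 vertex `z` whose feet `a, b, c` span exactly the
free pair `ab`.  THIS FILE: the feet span the two free pairs `ab, ac` (and not `bc`).  The conditioned `ac`-inequality of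
`adjForestNoSq_fibre_of_triangleClaw` is then the node's inequality on the fibre with `ac` PINNED (`fibreCount_forest_sep_of_mem`: both
one-sided conditionings of a free pair equal the pinned count), so the hypotheses are again the node on four smaller fibres:
`(N₀ ∪ {ac, zc}, u₀ ∪ {za, ab})`, `(N₀ ∪ {ac}, u₀ ∪ {ab})`, `(N₀ ∪ {ab}, u₀ ∪ {ac})`, `(N₀ ∪ {ac, ab, bc}, u₀)` — **`adjForestNoSq_fibre_of_triangleClaw_path`**.
(Three inner pairs make `{z,a,b,c}` a tight `K₄`, the tight-set regime of fk-1 g18/g20.)  Memo: bschramm/FROM-fk-1-g23-VERTEX-ELIMINATION.md §2.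
[cite: SempleWelsh2008, Conj. 1.1 (p. 2)] [cite: Linusson2011, Prop. 2.6] [cite: Grimmett2006, §1.5 (p. 13)]
-/

noncomputable section

namespace Summit.CriticalPhenomena.PercolationContinuityZ3.Theorems
namespace FK

open MeasureTheory Set Literature.Probability.LatticeModels Literature.Probability.Percolation
open scoped Classical symmDiff

variable {V : Type*} [Fintype V]

section PathClaw

variable {N₀ u₀ : BondConfig V} {z a b c : V} {e f : Sym2 V}

/-- **(♣)⁰ IS CLOSED UNDER ADDING A DEGREE-3 VERTEX WHOSE FEET SPAN A PATH (fibre form).**  `z` isolated in `N₀ ∪ u₀`; `ab, ac ∉ N₀ ∪ u₀`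
become free pairs, `bc` is not a pair of the fibre; `z, a, b, c` distinct; `z ∉ e, f`; `ab, ac, bc ≠ e, f`.  If the node's inequality holds on
`(N₀ ∪ {ac, zc}, u₀ ∪ {za, ab})`, `(N₀ ∪ {ac}, u₀ ∪ {ab})`, `(N₀ ∪ {ab}, u₀ ∪ {ac})` and `(N₀ ∪ {ac, ab, bc}, u₀)`, then it holds on
`(N₀ ∪ {ac, ab, za, zb, zc}, u₀)`.
[cite: SempleWelsh2008, Conj. 1.1 (p. 2)] [cite: Linusson2011, Prop. 2.6] [cite: Grimmett2006, §1.5 (p. 13)] -/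
theorem adjForestNoSq_fibre_of_triangleClaw_path (hz : ∀ g ∈ N₀ ∪ u₀, z ∉ g) (habN : s(a, b) ∉ N₀) (habu : s(a, b) ∉ u₀)
    (hacN : s(a, c) ∉ N₀) (hacu : s(a, c) ∉ u₀) (hbcN : s(b, c) ∉ N₀) (hbcu : s(b, c) ∉ u₀)
    (hza : z ≠ a) (hzb : z ≠ b) (hzc : z ≠ c) (hab : a ≠ b) (hac : a ≠ c) (hbc : b ≠ c)
    (hez : z ∉ e) (hfz : z ∉ f) (heab : s(a, b) ≠ e) (hfab : s(a, b) ≠ f) (heac : s(a, c) ≠ e) (hfac : s(a, c) ≠ f)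
    (hebc : s(b, c) ≠ e) (hfbc : s(b, c) ≠ f)
    (H1 : fibreCount (insert s(z, c) (insert s(a, c) N₀)) (insert s(z, a) (insert s(a, b) u₀)) (forestEv V ∩ {ω | e ∈ ω ∧ f ∈ ω})
        (forestEv V) ≤
      fibreCount (insert s(z, c) (insert s(a, c) N₀)) (insert s(z, a) (insert s(a, b) u₀)) (forestEv V ∩ {ω | e ∈ ω})
        (forestEv V ∩ {ω | f ∈ ω}))
    (H2 : fibreCount (insert s(a, c) N₀) (insert s(a, b) u₀) (forestEv V ∩ {ω | e ∈ ω ∧ f ∈ ω}) (forestEv V) ≤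
      fibreCount (insert s(a, c) N₀) (insert s(a, b) u₀) (forestEv V ∩ {ω | e ∈ ω}) (forestEv V ∩ {ω | f ∈ ω}))
    (H3 : fibreCount (insert s(a, b) N₀) (insert s(a, c) u₀) (forestEv V ∩ {ω | e ∈ ω ∧ f ∈ ω}) (forestEv V) ≤
      fibreCount (insert s(a, b) N₀) (insert s(a, c) u₀) (forestEv V ∩ {ω | e ∈ ω}) (forestEv V ∩ {ω | f ∈ ω}))
    (H4 : fibreCount (insert s(b, c) (insert s(a, b) (insert s(a, c) N₀))) u₀ (forestEv V ∩ {ω | e ∈ ω ∧ f ∈ ω}) (forestEv V) ≤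
      fibreCount (insert s(b, c) (insert s(a, b) (insert s(a, c) N₀))) u₀ (forestEv V ∩ {ω | e ∈ ω}) (forestEv V ∩ {ω | f ∈ ω})) :
    fibreCount (insert s(z, a) (insert s(z, b) (insert s(z, c) (insert s(a, b) (insert s(a, c) N₀))))) u₀
        (forestEv V ∩ {ω | e ∈ ω ∧ f ∈ ω}) (forestEv V) ≤
      fibreCount (insert s(z, a) (insert s(z, b) (insert s(z, c) (insert s(a, b) (insert s(a, c) N₀))))) u₀
        (forestEv V ∩ {ω | e ∈ ω}) (forestEv V ∩ {ω | f ∈ ω}) := by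
  have hU : ∀ (g : Sym2 V) (ω : BondConfig V), insert g ω ∈ (univ : Set (BondConfig V)) ↔ ω ∈ (univ : Set (BondConfig V)) :=
    fun g ω => by simp only [mem_univ]
  have habac : s(a, b) ≠ s(a, c) := fun h => hbc (Sym2.congr_right.1 h)
  have hbcab : s(b, c) ≠ s(a, b) := fun h => by
    have hc : c ∈ s(a, b) := h ▸ Sym2.mem_mk_right b c
    exact (Sym2.mem_iff.1 hc).elim (fun h' => hac h'.symm) (fun h' => hbc h'.symm)
  have hbcac : s(b, c) ≠ s(a, c) := fun h => by
    have hb : b ∈ s(a, c) := h ▸ Sym2.mem_mk_left b c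
    exact (Sym2.mem_iff.1 hb).elim (fun h' => hab h'.symm) (fun h' => hbc h')
  -- the base of `adjForestNoSq_fibre_of_triangleClaw` is `N = N₀ ∪ {ac}`
  have hz' : ∀ g ∈ insert s(a, c) N₀ ∪ u₀, z ∉ g := by
    rintro g hg hzg
    rcases hg with hg | hg
    · rcases mem_insert_iff.1 hg with rfl | hg
      · rcases Sym2.mem_iff.1 hzg with h | h
        · exact hza h
        · exact hzc h
      · exact hz g (Or.inl hg) hzg
    · exact hz g (Or.inr hg) hzg
  have habN' : s(a, b) ∉ insert s(a, c) N₀ := by rw [mem_insert_iff, not_or]; exact ⟨habac, habN⟩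
  have hbcM : s(b, c) ∉ insert s(a, b) (insert s(a, c) N₀) := by
    simp only [mem_insert_iff, not_or]; exact ⟨hbcab, hbcac, hbcN⟩
  refine adjForestNoSq_fibre_of_triangleClaw hz' habN' habu hza hzb hzc hab hac hbc hez hfz heab hfab H1 H2 ?_ ?_
  · -- the `ac` terms: `ac` is a free pair of `N ∪ {ab}`; both one-sided conditionings are the count with `ac` pinned
    have hacM : s(a, c) ∉ insert s(a, b) N₀ := by rw [mem_insert_iff, not_or]; exact ⟨habac.symm, hacN⟩
    have hswap : insert s(a, b) (insert s(a, c) N₀) = insert s(a, c) (insert s(a, b) N₀) := Set.insert_comm _ _ _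
    rw [hswap]
    have A := fibreCount_forest_sep_of_mem (P := {ω | e ∈ ω ∧ f ∈ ω}) (Q := univ) hac hacM hacu (insert_mem_pairEv₂_iff heac hfac) (hU _)
    have B := fibreCount_forest_sep_of_mem (P := univ) (Q := {ω | e ∈ ω ∧ f ∈ ω}) hac hacM hacu (hU _) (insert_mem_pairEv₂_iff heac hfac)
    have C := fibreCount_forest_sep_of_mem (P := {ω | e ∈ ω}) (Q := {ω | f ∈ ω}) hac hacM hacu (insert_mem_pairEv_iff heac)
      (insert_mem_pairEv_iff hfac)
    have D := fibreCount_forest_sep_of_mem (P := {ω | f ∈ ω}) (Q := {ω | e ∈ ω}) hac hacM hacu (insert_mem_pairEv_iff hfac)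
      (insert_mem_pairEv_iff heac)
    simp only [Set.inter_univ] at A B
    have l2 : fibreCount (insert s(a, c) (insert s(a, b) N₀)) u₀ (forestEv V ∩ {ω | e ∈ ω ∧ f ∈ ω})
        (forestEv V ∩ {ω | ¬ (openGraph ω).Reachable a c}) =
        fibreCount (insert s(a, b) N₀) (insert s(a, c) u₀) (forestEv V ∩ {ω | e ∈ ω ∧ f ∈ ω}) (forestEv V) := by
      rw [fibreCount_swap, B, fibreCount_swap]
    have r2 : fibreCount (insert s(a, c) (insert s(a, b) N₀)) u₀ (forestEv V ∩ {ω | e ∈ ω})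
        (forestEv V ∩ {ω | ¬ (openGraph ω).Reachable a c} ∩ {ω | f ∈ ω}) =
        fibreCount (insert s(a, b) N₀) (insert s(a, c) u₀) (forestEv V ∩ {ω | e ∈ ω}) (forestEv V ∩ {ω | f ∈ ω}) := by
      rw [fibreCount_swap, D, fibreCount_swap]
    rw [A, l2, C, r2]
    omega
  · have A := fibreCount_forest_sep_add_of_notMem hbc hbcM hbcu (insert_mem_pairEv₂_iff hebc hfbc) (hU _)
    have B := fibreCount_forest_sep_add_of_notMem hbc hbcM hbcu (insert_mem_pairEv_iff hebc) (insert_mem_pairEv_iff hfbc)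
    simp only [Set.inter_univ] at A
    rw [A, B]; exact H4

end PathClaw

end FK
end Summit.CriticalPhenomena.PercolationContinuityZ3.Theorems

end
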